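import Literature.Barriers.HubbardSuperconductivity.OrderParameterInvisibleToGroundStateConstraints
import HarnessLib

/-!
# Excluding a class of states from the ground-state set by a certified energy ordering (Rayleigh–Ritz)

Finite-dimensional, density-matrix setting of
`Literature/Barriers/HubbardSuperconductivity/OrderParameterInvisibleToGroundStateConstraints.lean`
(`IsDensityMatrix`, `IsGroundStateDensityMatrix H ρ` = a density matrix minimising `Re Tr(ρH)` among all
density matrices). That barrier records what ground-state-valid constraints can NEVER give (a positive
FLOOR on a symmetry-odd order parameter). This file records, in the same words, the positive counterpart
that a pair of certified energy bounds DOES give — the exclusion of a named class of candidate states: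

* `classExcluded_of_floor_gt_ceiling` — if every density matrix in a class `C` has energy `≥ ℓ`
  (a certified CLASS FLOOR), some density matrix `ψ` has energy `≤ u` (a certified ground-state CEILING,
  e.g. the interval-evaluated energy of an explicit state) and `u < ℓ`, then NO ground-state density matrix
  lies in `C` (Rayleigh–Ritz: a ground state has energy `≤ Re Tr(ψH) ≤ u < ℓ`).
* `observable_le_of_energyCeiling` / `not_isGroundState_of_observable_gt` — the contrapositive reading of
  an observable CEILING certified on the sub-level set `{σ : Re Tr(σH) ≤ u}` («`⟨O⟩ ≤ c` for every state of
  energy `≤ u`», the shape of every moment-relaxation ceiling row): every ground state has `⟨O⟩ ≤ c`, and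
  every density matrix with `⟨O⟩ > c` lies strictly above `u` in energy, hence is not a ground state —
  the class `{σ : c < Re Tr(σO)}` is excluded.
* `classFloor_of_observable_ceiling` — the same ceiling read as a class floor: `u` is an energy floor for
  the class `{σ : c < Re Tr(σO)}` (strict form), the input shape of `classExcluded_of_floor_gt_ceiling`.

Everything is elementary and PROVED; the tags cite the printed statements formalised — the variational
principle (Reed–Simon IV, Thm XIII.1 with `n = 1`) for the exclusion lemmas, and the bootstrap papers'
reading of certified order-parameter UPPER bounds as evidence AGAINST an order (Scheer–Chadha–Lu–Khalaf
2025 p. 5; Han 2020 p. 7, Table 4) for the ceiling lemmas; no definition and no named fact is introduced. Deliberately NOT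
here: thermodynamic-limit / sector versions (the torus-sector predicates `IsGroundStateInSector` live in
`HubbardModel.lean`; the same three-line argument applies verbatim and is left to the consumer), and any
statement producing PRESENCE of an order (impossible from such data — the barrier file's theorem).
-/

namespace Literature.MathematicalPhysics.QuantumLattice

open Matrix Literature.Barriers.HubbardSuperconductivity

variable {n : Type*} [Fintype n]

/-- A ground-state density matrix has energy at most that of any density matrix (the defining
minimality, restated for use with an explicit witness `ψ`) — the variational principle. [cite: ReedSimonIV1978, Thm XIII.1 (n = 1: variational characterisation of the ground-state energy)] -/
theorem groundState_energy_le_witness {H ρ ψ : Matrix n n ℂ} (hρ : IsGroundStateDensityMatrix H ρ)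
    (hψ : IsDensityMatrix ψ) : (ρ * H).trace.re ≤ (ψ * H).trace.re :=
  hρ.2 ψ hψ

/-- Any two ground-state density matrices have the same energy. [cite: ReedSimonIV1978, Thm XIII.1 (n = 1: variational characterisation of the ground-state energy)] -/
theorem groundState_energy_eq {H ρ ρ' : Matrix n n ℂ} (hρ : IsGroundStateDensityMatrix H ρ)
    (hρ' : IsGroundStateDensityMatrix H ρ') : (ρ * H).trace.re = (ρ' * H).trace.re :=
  le_antisymm (hρ.2 ρ' hρ'.1) (hρ'.2 ρ hρ.1)

/-- **Class exclusion from a certified energy ordering (Rayleigh–Ritz).** Let `C` be any class of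
matrices («candidate competing states»: a stripe pattern, a uniform pair-ordered class, saturated
ferromagnets, quasi-free states, …). If every density matrix in `C` has energy `Re Tr(σH) ≥ ℓ`
(certified class floor), some density matrix `ψ` has `Re Tr(ψH) ≤ u` (certified ceiling on the
ground-state energy) and `u < ℓ`, then no ground-state density matrix of `H` belongs to `C`.
[cite: ReedSimonIV1978, Thm XIII.1 (n = 1: variational characterisation of the ground-state energy)] -/
theorem classExcluded_of_floor_gt_ceiling {H ψ : Matrix n n ℂ} {C : Matrix n n ℂ → Prop} {ℓ u : ℝ}
    (hfloor : ∀ σ : Matrix n n ℂ, IsDensityMatrix σ → C σ → ℓ ≤ (σ * H).trace.re)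
    (hψ : IsDensityMatrix ψ) (hψu : (ψ * H).trace.re ≤ u) (hul : u < ℓ) :
    ∀ ρ : Matrix n n ℂ, IsGroundStateDensityMatrix H ρ → ¬ C ρ := by
  intro ρ hρ hC
  have h1 : (ρ * H).trace.re ≤ u := (groundState_energy_le_witness hρ hψ).trans hψu
  have h2 : ℓ ≤ (ρ * H).trace.re := hfloor ρ hρ.1 hC
  exact absurd (h2.trans h1) (not_le.mpr hul)

/-- Margin form of `classExcluded_of_floor_gt_ceiling`: with a certified class floor `ℓ` and a certified
ground-state ceiling `u`, every ground state lies OUTSIDE the class as soon as the printed margin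
`ℓ - u` is positive. [cite: ReedSimonIV1978, Thm XIII.1 (n = 1: variational characterisation of the ground-state energy)] -/
theorem classExcluded_of_margin_pos {H ψ : Matrix n n ℂ} {C : Matrix n n ℂ → Prop} {ℓ u : ℝ}
    (hfloor : ∀ σ : Matrix n n ℂ, IsDensityMatrix σ → C σ → ℓ ≤ (σ * H).trace.re)
    (hψ : IsDensityMatrix ψ) (hψu : (ψ * H).trace.re ≤ u) (hmargin : 0 < ℓ - u) :
    ∀ ρ : Matrix n n ℂ, IsGroundStateDensityMatrix H ρ → ¬ C ρ :=
  classExcluded_of_floor_gt_ceiling hfloor hψ hψu (sub_pos.mp hmargin)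

/-- **An observable ceiling on an energy sub-level set bounds every ground state.** If `Re Tr(σO) ≤ c`
for every density matrix `σ` with `Re Tr(σH) ≤ u` (the shape of a certified moment-relaxation ceiling:
the energy row `≤ u` is among the constraints), and some density matrix `ψ` has energy `≤ u`, then every
ground-state density matrix satisfies `Re Tr(ρO) ≤ c` ("one can provide strong evidence against a given
SSB order in some model by bounding the order parameter expectation value"). [cite: ScheerEtAl2025, p. 5] [cite: Han2020Bootstrap, p. 7 and Table 4] -/
theorem observable_le_of_energyCeiling {H O ψ : Matrix n n ℂ} {u c : ℝ}
    (hceil : ∀ σ : Matrix n n ℂ, IsDensityMatrix σ → (σ * H).trace.re ≤ u → (σ * O).trace.re ≤ c)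
    (hψ : IsDensityMatrix ψ) (hψu : (ψ * H).trace.re ≤ u) :
    ∀ ρ : Matrix n n ℂ, IsGroundStateDensityMatrix H ρ → (ρ * O).trace.re ≤ c :=
  fun ρ hρ => hceil ρ hρ.1 ((groundState_energy_le_witness hρ hψ).trans hψu)

/-- **The same ceiling read as an energy ORDERING (class floor, strict form).** Under the ceiling
hypothesis of `observable_le_of_energyCeiling`, every density matrix whose observable EXCEEDS `c` has
energy strictly above `u`: the class `{σ : c < Re Tr(σO)}` («order stronger than `c`») lies above the
certified ceiling — a competing state of energy `≤ u` is certified LOWER than any such state.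
[cite: ScheerEtAl2025, p. 5] [cite: Han2020Bootstrap, p. 7 and Table 4] -/
theorem classFloor_of_observable_ceiling {H O : Matrix n n ℂ} {u c : ℝ}
    (hceil : ∀ σ : Matrix n n ℂ, IsDensityMatrix σ → (σ * H).trace.re ≤ u → (σ * O).trace.re ≤ c) :
    ∀ σ : Matrix n n ℂ, IsDensityMatrix σ → c < (σ * O).trace.re → u < (σ * H).trace.re :=
  fun σ hσ hc => lt_of_not_ge fun hle => absurd (hceil σ hσ hle) (not_le.mpr hc)

/-- **Exclusion of the strong-order class.** Under the ceiling hypothesis of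
`observable_le_of_energyCeiling` and with a witness `ψ` of energy `≤ u`, no density matrix with
`Re Tr(σO) > c` is a ground state. [cite: ScheerEtAl2025, p. 5] [cite: Han2020Bootstrap, p. 7 and Table 4] -/
theorem not_isGroundState_of_observable_gt {H O ψ : Matrix n n ℂ} {u c : ℝ}
    (hceil : ∀ σ : Matrix n n ℂ, IsDensityMatrix σ → (σ * H).trace.re ≤ u → (σ * O).trace.re ≤ c)
    (hψ : IsDensityMatrix ψ) (hψu : (ψ * H).trace.re ≤ u) {σ : Matrix n n ℂ}
    (hσ : c < (σ * O).trace.re) : ¬ IsGroundStateDensityMatrix H σ :=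
  fun hgs => absurd (observable_le_of_energyCeiling hceil hψ hψu σ hgs) (not_le.mpr hσ)

/-- **Two certified classes at once.** Exclusions compose: if classes `C₁` and `C₂` are each excluded
by a floor above the common ceiling `u`, so is their union — the bookkeeping behind a per-cell list of
excluded candidates. [cite: ReedSimonIV1978, Thm XIII.1 (n = 1: variational characterisation of the ground-state energy)] -/
theorem classExcluded_union {H ψ : Matrix n n ℂ} {C₁ C₂ : Matrix n n ℂ → Prop} {ℓ₁ ℓ₂ u : ℝ}
    (h₁ : ∀ σ : Matrix n n ℂ, IsDensityMatrix σ → C₁ σ → ℓ₁ ≤ (σ * H).trace.re)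
    (h₂ : ∀ σ : Matrix n n ℂ, IsDensityMatrix σ → C₂ σ → ℓ₂ ≤ (σ * H).trace.re)
    (hψ : IsDensityMatrix ψ) (hψu : (ψ * H).trace.re ≤ u) (hu₁ : u < ℓ₁) (hu₂ : u < ℓ₂) :
    ∀ ρ : Matrix n n ℂ, IsGroundStateDensityMatrix H ρ → ¬ (C₁ ρ ∨ C₂ ρ) := by
  intro ρ hρ h
  rcases h with h | h
  · exact classExcluded_of_floor_gt_ceiling h₁ hψ hψu hu₁ ρ hρ h
  · exact classExcluded_of_floor_gt_ceiling h₂ hψ hψu hu₂ ρ hρ h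

end Literature.MathematicalPhysics.QuantumLattice
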